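import Summits.BirchSwinnertonDyer.BirchSwinnertonDyer.Theorems.CMKolyvaginAtInertTwoPairAssemblyRankOneSideAtTwo
import HarnessLib

/-!
# Route `CMKolyvaginAtInertTwo`, crux `CMKolyvaginExactAtInertTwo` (stmt-BirchSwinnertonDyer-24277):
# the POINT-FREE rank inputs of `card_mul_card_le_two_pow_two_mul_of_pairData_cmInert_of_finite` — `hinjT` on the
# rank-ZERO member from "`A(F)` is torsion without `2`-torsion", and `hkerT` on the rank-ONE member from a generator

Seat `bsd-line-cmk2-p1` g17 (cell `bsd-print-cf2`); helper (`--supports stmt-BirchSwinnertonDyer-24277`).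
THEOREMS ONLY: no definition, no named fact, no `sorry`; no item is closed; BSD is not proved by this.

`…_cmInert_of_finite` (p721644) displays `hinjT : ∀ z ∈ Sel_{2^M}(E^{(d_K)}), (z ↦ H¹(ℚ,E^{(d_K)})) z = 0 → z = 0` and
`hkerT : ∀ z ∈ Sel_{2^M}(E), (z dies in H¹(ℚ,E)) ↔ z ∈ ℤ·D.x`. Both are Kummer exactness read against Mordell–Weil (stated over
a generic number field `F`, so in the CLASSICAL `DecidableEq` currency of the tree's Kummer files — KERNEL-STATUS §17.9):

* `eq_zero_of_torsionH1ToH1_eq_zero_of_torsion` — **rank zero**: if every point of `A(F)` is torsion and `A(F)[2] = 0`, a class of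
  `H¹(F, A[2^M])` dying in `H¹(F, A)` is `δ_M(P) = 0` (`P` has odd order, hence is `2^M`-divisible);
* `torsionH1ToH1_eq_zero_iff_mem_zmultiples_of_generator` — **rank one**: with `g` a generator modulo torsion, `A(F)[2] = 0`,
  `x₀ = k g + t₀` (`k` odd, `t₀` torsion): a class of `Sel_{2^M}` dies in `H¹(F, A)` iff it lies in `ℤ·δ_M(x₀)` (p718128's kernel
  statement, read without the map `ι`).

References: [SilvermanAEC2009] VIII.§2, X.4.2; [McCallumLMS1991] §5 Lemma 5.1.
-/

-- single-conjunct summit: `Summit.BirchSwinnertonDyer.BirchSwinnertonDyer.…` repeats the name by design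
set_option linter.dupNamespace false
set_option autoImplicit false

noncomputable section

open scoped Classical
open scoped AddSubgroup

namespace Summit.BirchSwinnertonDyer.BirchSwinnertonDyer.Theorems.KolyvaginPairDataTwo

open WeierstrassCurve NumberField Field
open Literature.NumberTheory.EllipticCurves Literature.NumberTheory.GaloisRepresentations
open Summit.BirchSwinnertonDyer.BirchSwinnertonDyer.Theorems.GenusExact.VisiblePairAtTwo

variable {F : Type} [Field F] [NumberField F] (A : WeierstrassCurve F) [A.IsElliptic] (M : ℕ)

/-- **Rank zero: `Sel_{2^M}(A/F) → H¹(F, A)` is injective when `A(F)` is torsion without `2`-torsion.** A class dying in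
`H¹(F, A)` is a Kummer class `δ_M(P)`; `P` has odd order, so `P ∈ 2^M A(F)` and `δ_M(P) = 0`.
[cite: SilvermanAEC2009, VIII.§2 and Thm. X.4.2 (a)] -/
theorem eq_zero_of_torsionH1ToH1_eq_zero_of_torsion
    (h2 : ∀ P : A.toAffine.Point, (2 : ℤ) • P = 0 → P = 0) (htors : ∀ P : A.toAffine.Point, IsOfFinAddOrder P)
    {z : galH1Torsion A (lvl M)} (hz : torsionH1ToH1 A (lvl M) z = 0) : z = 0 := by
  obtain ⟨P, rfl⟩ := exists_kummerMapTorsion_eq_of_torsionH1ToH1_eq_zero A M hz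
  obtain ⟨u, hu⟩ := exists_two_pow_zsmul_eq_of_isOfFinAddOrder h2 (htors P) M
  exact (kummerMapTorsion_eq_zero_iff A M P).mpr ⟨u • P, hu⟩

/-- **Rank one, point-free form of p718128**: with `g` generating `A(F)` modulo torsion, `A(F)[2] = 0`, `x₀ = k g + t₀`
(`k` odd, `t₀` torsion), a Selmer class dies in `H¹(F, A)` iff it lies in `ℤ·δ_M(x₀)`.
[cite: SilvermanAEC2009, VIII.§2 and Thm. X.4.2 (a)] [cite: McCallumLMS1991, §5 Lemma 5.1] -/
theorem torsionH1ToH1_eq_zero_iff_mem_zmultiples_of_generator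
    (h2 : ∀ P : A.toAffine.Point, (2 : ℤ) • P = 0 → P = 0)
    (g : A.toAffine.Point)
    (hgen : ∀ P : A.toAffine.Point, ∃ (n : ℤ) (t : A.toAffine.Point), IsOfFinAddOrder t ∧ P = n • g + t)
    {x₀ t₀ : A.toAffine.Point} {k : ℕ} (hk : Odd k) (ht₀ : IsOfFinAddOrder t₀) (hx₀ : x₀ = (k : ℤ) • g + t₀)
    (z : selmerGroup A (lvl M)) :
    torsionH1ToH1 A (lvl M) z = 0 ↔
      (z : galH1Torsion A (lvl M)) ∈ AddSubgroup.zmultiples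
        (kummerMapTorsion A (lvl M) (A.zsmul_geomPoints_surjective_holds (lvl_ne_zero M)) x₀) := by
  set κ := kummerMapTorsion A (lvl M) (A.zsmul_geomPoints_surjective_holds (lvl_ne_zero M)) with hκ
  have hκt : ∀ t : A.toAffine.Point, IsOfFinAddOrder t → κ t = 0 := by
    intro t ht
    obtain ⟨u, hu⟩ := exists_two_pow_zsmul_eq_of_isOfFinAddOrder h2 ht M
    exact (kummerMapTorsion_eq_zero_iff A M t).mpr ⟨u • t, hu⟩
  -- `κ g = k' • κ x₀` for `k k' ≡ 1 (mod 2^M)` (as in p718128)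
  have hκg : ∃ k' : ℤ, κ g = k' • κ x₀ := by
    by_cases hM : M = 0
    · refine ⟨0, ?_⟩
      subst hM
      have h := zsmul_galH1Torsion_eq_zero A (lvl 0) (κ g)
      have e : (lvl 0 : ℤ) = 1 := by simp [lvl]
      have h1 : (1 : ℤ) • κ g = 0 := by
        have h2' := congrArg (fun c : ℤ => c • κ g) e
        rw [← h2']
        exact h
      rw [one_zsmul] at h1
      rw [h1, zero_zsmul]
    have h1 : 1 < 2 ^ M := Nat.one_lt_two_pow hM
    have hcop : Nat.Coprime k (2 ^ M) := ((Nat.coprime_two_left.mpr hk).pow_left M).symm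
    obtain ⟨u, -, hu⟩ := Nat.exists_mul_mod_eq_one_of_coprime hcop h1
    obtain ⟨q, hq⟩ : ∃ q : ℕ, k * u = 2 ^ M * q + 1 :=
      ⟨k * u / 2 ^ M, by have h := Nat.div_add_mod (k * u) (2 ^ M); rw [hu] at h; exact h.symm⟩
    refine ⟨(u : ℤ), ?_⟩
    have hdecomp : ((u : ℤ) * (k : ℤ)) = 1 + (lvl M : ℤ) * (q : ℤ) := by
      have h' : ((k * u : ℕ) : ℤ) = ((2 ^ M * q + 1 : ℕ) : ℤ) := by rw [hq]
      push_cast at h'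
      rw [mul_comm]
      simp only [lvl, Nat.cast_pow, Nat.cast_ofNat]
      linarith
    rw [hx₀, map_add, hκt t₀ ht₀, add_zero, map_zsmul, smul_smul, hdecomp, add_zsmul, one_zsmul, ← smul_smul,
      zsmul_galH1Torsion_eq_zero, add_zero]
  obtain ⟨k', hk'⟩ := hκg
  rw [AddSubgroup.mem_zmultiples_iff]
  constructor
  · intro hz
    obtain ⟨P, hP⟩ := exists_kummerMapTorsion_eq_of_torsionH1ToH1_eq_zero A M hz
    obtain ⟨n, t, ht, rfl⟩ := hgen P
    refine ⟨n * k', ?_⟩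
    rw [← hP, map_add, hκt t ht, add_zero, map_zsmul, hk', smul_smul]
  · rintro ⟨a, ha⟩
    rw [← ha, map_zsmul, hκ, torsionH1ToH1_kummerMapTorsion, zsmul_zero]

end Summit.BirchSwinnertonDyer.BirchSwinnertonDyer.Theorems.KolyvaginPairDataTwo

end
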